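import Summits.Ventures.PercRepro.RankLevelSetUpChain
import Summits.Ventures.PercRepro.RankLevelSetPerElemNullityAll
import Summits.Ventures.PercRepro.RankLevelSetBiIndepSumPerElem

/-! # RankLevelSetUpColoop — THE COLOOP REDUCTIONS OF (↑) (night-1 g38; dossier §50; on `RankLevelSetUpChain` and
`RankLevelSetPerElemNullityAll`)

A coloop `c` of `M` lies on either side of a bi-independent partition freely: the bi-independent `k`-sets of `M` not
containing `c` are those of `M ＼ c`, and those containing `c` are `insert c` of the bi-independent `(k − 1)`-sets
of `M ＼ c` (**`mem_biIndep_delete_iff_of_notMem`**, **`mem_biIndep_iff_sdiff_of_mem`**). Hence for `b ≠ c` the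
through-`b` and avoid-`b` counts of `M` are the sums of those of `M ＼ c` at two consecutive levels
(**`through_ncard_of_isColoop`**, **`avoid_ncard_of_isColoop`**), and (↑) at level `k` for `M` follows from (↑) at
the levels `k` and `k − 1` for `M ＼ c` (**`upAt_of_isColoop`**); at `b = c` itself the counts are the profile values
`D_{k−1}` and `D_{k+1}` of `M ＼ c`, so (↑) follows from `BiIndepMono (M ＼ c)` (**`upAt_self_of_isColoop`**), which
holds on nullity `≤ 4` (`biIndepMono_of_nullity`; the nullity of `M ＼ c` is that of `M`,
**`eRank_dual_delete_isColoop_le`**). Every declaration has a docstring; imports: the cell's own modules and Mathlib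
only. Axioms: standard. -/

namespace PercRepro

open Set Matroid

variable {α : Type} (M : Matroid α) [M.Finite]

/-! ## Bi-independent sets and a coloop -/

omit [M.Finite] in
/-- **A bi-independent set not containing the coloop `c` is bi-independent in `M ＼ c`, and conversely.** -/
lemma mem_biIndep_delete_iff_of_notMem {c : α} (hc : M.IsColoop c) {k : ℕ} {W : Set α} (hcW : c ∉ W) :
    W ∈ biIndep M k ↔ W ∈ biIndep (M.delete {c}) k := by
  simp only [biIndep, Set.mem_setOf_eq, Matroid.delete_ground, Matroid.delete_indep_iff,
    Set.disjoint_singleton_right]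
  constructor
  · rintro ⟨hWE, hWk, hWi, hWc⟩
    refine ⟨fun x hx => ⟨hWE hx, fun h => hcW (by rw [Set.mem_singleton_iff] at h; rw [← h]; exact hx)⟩, hWk,
      ⟨hWi, hcW⟩, hWc.subset (Set.sdiff_subset_sdiff_left Set.sdiff_subset), fun h => h.1.2 rfl⟩
  · rintro ⟨hWE, hWk, ⟨hWi, -⟩, hWc, -⟩
    refine ⟨hWE.trans Set.sdiff_subset, hWk, hWi, ?_⟩
    have heq : M.E \ W = insert c ((M.E \ {c}) \ W) := by
      ext x
      simp only [Set.mem_sdiff, Set.mem_insert_iff, Set.mem_singleton_iff]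
      constructor
      · rintro ⟨hxE, hxW⟩
        by_cases hxc : x = c
        · exact Or.inl hxc
        · exact Or.inr ⟨⟨hxE, hxc⟩, hxW⟩
      · rintro (rfl | ⟨⟨hxE, -⟩, hxW⟩)
        · exact ⟨hc.mem_ground, hcW⟩
        · exact ⟨hxE, hxW⟩
    rw [heq]
    exact hc.insert_indep_of_indep hWc

/-- **A bi-independent set containing the coloop `c` is `insert c` of a bi-independent set of `M ＼ c` one level
down, and conversely.** -/
lemma mem_biIndep_iff_sdiff_of_mem {c : α} (hc : M.IsColoop c) {k : ℕ} {W : Set α} (hcW : c ∈ W) :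
    W ∈ biIndep M (k + 1) ↔ W \ {c} ∈ biIndep (M.delete {c}) k := by
  have heq : (M.E \ {c}) \ (W \ {c}) = M.E \ W := by
    ext x
    simp only [Set.mem_sdiff, Set.mem_singleton_iff, not_and, not_not]
    constructor
    · rintro ⟨⟨hxE, hxc⟩, h⟩
      exact ⟨hxE, fun hxW => hxc (h hxW)⟩
    · rintro ⟨hxE, hxW⟩
      exact ⟨⟨hxE, fun hxc => hxW (hxc ▸ hcW)⟩, fun h => absurd h hxW⟩
  have hdj1 : Disjoint (W \ {c}) {c} := Set.disjoint_sdiff_left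
  have hdj2 : Disjoint (M.E \ W) {c} := by
    rw [Set.disjoint_singleton_right]; exact fun h => h.2 hcW
  rw [biIndep, biIndep, Set.mem_setOf_eq, Set.mem_setOf_eq, Matroid.delete_ground, heq]
  constructor
  · rintro ⟨hWE, hWk, hWi, hWc⟩
    refine ⟨Set.sdiff_subset_sdiff_left hWE, ?_, Matroid.delete_indep_iff.mpr ⟨hWi.subset Set.sdiff_subset, hdj1⟩,
      Matroid.delete_indep_iff.mpr ⟨hWc, hdj2⟩⟩
    rw [Set.ncard_sdiff_singleton_of_mem hcW, hWk]; rfl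
  · rintro ⟨hWE, hWk, hWi, hWc⟩
    have hWi' : M.Indep (W \ {c}) := (Matroid.delete_indep_iff.mp hWi).1
    have hWc' : M.Indep (M.E \ W) := (Matroid.delete_indep_iff.mp hWc).1
    have hW' : W = insert c (W \ {c}) := by rw [Set.insert_sdiff_singleton, Set.insert_eq_of_mem hcW]
    refine ⟨?_, ?_, ?_, hWc'⟩
    · intro x hx
      by_cases hxc : x = c
      · rw [hxc]; exact hc.mem_ground
      · exact (hWE ⟨hx, hxc⟩).1
    · have hfin : (W \ {c}).Finite := M.ground_finite.subset (hWE.trans Set.sdiff_subset)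
      rw [hW', Set.ncard_insert_of_notMem (fun h => h.2 rfl) hfin, hWk]
    · rw [hW']; exact hc.insert_indep_of_indep hWi'

/-! ## The counts -/

/-- **THE THROUGH-`b` COUNT ACROSS A COLOOP** (`b ≠ c`): `T_k(M) = T_k(M ＼ c) + T_{k−1}(M ＼ c)`. -/
lemma through_ncard_of_isColoop {c : α} (hc : M.IsColoop c) {b : α} (hbc : b ≠ c) (k : ℕ) :
    {W ∈ biIndep M (k + 1) | b ∈ W}.ncard =
      {W ∈ biIndep (M.delete {c}) (k + 1) | b ∈ W}.ncard + {W ∈ biIndep (M.delete {c}) k | b ∈ W}.ncard := by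
  classical
  haveI : (M.delete {c}).Finite := ⟨M.ground_finite.subset Set.sdiff_subset⟩
  have hsplit : {W ∈ biIndep M (k + 1) | b ∈ W} =
      {W ∈ biIndep M (k + 1) | b ∈ W ∧ c ∉ W} ∪ {W ∈ biIndep M (k + 1) | b ∈ W ∧ c ∈ W} := by
    ext W; simp only [Set.mem_union, Set.mem_setOf_eq]; tauto
  have hdisj : Disjoint {W ∈ biIndep M (k + 1) | b ∈ W ∧ c ∉ W} {W ∈ biIndep M (k + 1) | b ∈ W ∧ c ∈ W} := by
    rw [Set.disjoint_left]; rintro W ⟨-, -, h1⟩ ⟨-, -, h2⟩; exact h1 h2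
  have hfin1 : {W ∈ biIndep M (k + 1) | b ∈ W ∧ c ∉ W}.Finite := (biIndep_finite M _).subset (fun _ h => h.1)
  have hfin2 : {W ∈ biIndep M (k + 1) | b ∈ W ∧ c ∈ W}.Finite := (biIndep_finite M _).subset (fun _ h => h.1)
  rw [hsplit, Set.ncard_union_eq hdisj hfin1 hfin2]
  congr 1
  · refine Set.ncard_congr (fun W _ => W) ?_ ?_ ?_
    · rintro W ⟨hW, hbW, hcW⟩
      exact ⟨(mem_biIndep_delete_iff_of_notMem M hc hcW).mp hW, hbW⟩
    · intro W W' _ _ h; exact h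
    · rintro W ⟨hW, hbW⟩
      have hcW : c ∉ W := fun h => (hW.1 h).2 rfl
      exact ⟨W, ⟨(mem_biIndep_delete_iff_of_notMem M hc hcW).mpr hW, hbW, hcW⟩, rfl⟩
  · refine Set.ncard_congr (fun W _ => W \ {c}) ?_ ?_ ?_
    · rintro W ⟨hW, hbW, hcW⟩
      exact ⟨(mem_biIndep_iff_sdiff_of_mem M hc hcW).mp hW, ⟨hbW, hbc⟩⟩
    · rintro W W' ⟨-, -, hcW⟩ ⟨-, -, hcW'⟩ h
      have h1 : insert c (W \ {c}) = insert c (W' \ {c}) := by rw [h]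
      rwa [Set.insert_sdiff_singleton, Set.insert_sdiff_singleton, Set.insert_eq_of_mem hcW,
        Set.insert_eq_of_mem hcW'] at h1
    · rintro U ⟨hU, hbU⟩
      have hcU : c ∉ U := fun h => (hU.1 h).2 rfl
      refine ⟨insert c U, ⟨?_, Set.mem_insert_of_mem c hbU, Set.mem_insert c U⟩, ?_⟩
      · rw [mem_biIndep_iff_sdiff_of_mem M hc (Set.mem_insert c U), Set.insert_sdiff_of_mem _ (Set.mem_singleton c),
          Set.sdiff_singleton_eq_self hcU]
        exact hU
      · rw [Set.insert_sdiff_of_mem _ (Set.mem_singleton c), Set.sdiff_singleton_eq_self hcU]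

/-- **THE AVOID-`b` COUNT ACROSS A COLOOP** (`b ≠ c`): `V_{k+1}(M) = V_{k+1}(M ＼ c) + V_k(M ＼ c)`. -/
lemma avoid_ncard_of_isColoop {c : α} (hc : M.IsColoop c) {b : α} (hbc : b ≠ c) (k : ℕ) :
    {Z ∈ biIndep M (k + 1) | b ∉ Z}.ncard =
      {Z ∈ biIndep (M.delete {c}) (k + 1) | b ∉ Z}.ncard + {Z ∈ biIndep (M.delete {c}) k | b ∉ Z}.ncard := by
  classical
  haveI : (M.delete {c}).Finite := ⟨M.ground_finite.subset Set.sdiff_subset⟩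
  have hsplit : {Z ∈ biIndep M (k + 1) | b ∉ Z} =
      {Z ∈ biIndep M (k + 1) | b ∉ Z ∧ c ∉ Z} ∪ {Z ∈ biIndep M (k + 1) | b ∉ Z ∧ c ∈ Z} := by
    ext Z; simp only [Set.mem_union, Set.mem_setOf_eq]; tauto
  have hdisj : Disjoint {Z ∈ biIndep M (k + 1) | b ∉ Z ∧ c ∉ Z} {Z ∈ biIndep M (k + 1) | b ∉ Z ∧ c ∈ Z} := by
    rw [Set.disjoint_left]; rintro Z ⟨-, -, h1⟩ ⟨-, -, h2⟩; exact h1 h2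
  have hfin1 : {Z ∈ biIndep M (k + 1) | b ∉ Z ∧ c ∉ Z}.Finite := (biIndep_finite M _).subset (fun _ h => h.1)
  have hfin2 : {Z ∈ biIndep M (k + 1) | b ∉ Z ∧ c ∈ Z}.Finite := (biIndep_finite M _).subset (fun _ h => h.1)
  rw [hsplit, Set.ncard_union_eq hdisj hfin1 hfin2]
  congr 1
  · refine Set.ncard_congr (fun Z _ => Z) ?_ ?_ ?_
    · rintro Z ⟨hZ, hbZ, hcZ⟩
      exact ⟨(mem_biIndep_delete_iff_of_notMem M hc hcZ).mp hZ, hbZ⟩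
    · intro Z Z' _ _ h; exact h
    · rintro Z ⟨hZ, hbZ⟩
      have hcZ : c ∉ Z := fun h => (hZ.1 h).2 rfl
      exact ⟨Z, ⟨(mem_biIndep_delete_iff_of_notMem M hc hcZ).mpr hZ, hbZ, hcZ⟩, rfl⟩
  · refine Set.ncard_congr (fun Z _ => Z \ {c}) ?_ ?_ ?_
    · rintro Z ⟨hZ, hbZ, hcZ⟩
      exact ⟨(mem_biIndep_iff_sdiff_of_mem M hc hcZ).mp hZ, fun h => hbZ h.1⟩
    · rintro Z Z' ⟨-, -, hcZ⟩ ⟨-, -, hcZ'⟩ h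
      have h1 : insert c (Z \ {c}) = insert c (Z' \ {c}) := by rw [h]
      rwa [Set.insert_sdiff_singleton, Set.insert_sdiff_singleton, Set.insert_eq_of_mem hcZ,
        Set.insert_eq_of_mem hcZ'] at h1
    · rintro U ⟨hU, hbU⟩
      have hcU : c ∉ U := fun h => (hU.1 h).2 rfl
      refine ⟨insert c U, ⟨?_, ?_, Set.mem_insert c U⟩, ?_⟩
      · rw [mem_biIndep_iff_sdiff_of_mem M hc (Set.mem_insert c U), Set.insert_sdiff_of_mem _ (Set.mem_singleton c),
          Set.sdiff_singleton_eq_self hcU]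
        exact hU
      · rintro (h | h)
        · exact hbc h
        · exact hbU h
      · rw [Set.insert_sdiff_of_mem _ (Set.mem_singleton c), Set.sdiff_singleton_eq_self hcU]

/-- **(↑) AT LEVEL `k + 1` ACROSS A COLOOP `c ≠ b`**: from (↑) at the levels `k + 1` and `k` for `M ＼ c`. -/
theorem upAt_of_isColoop {c : α} (hc : M.IsColoop c) {b : α} (hbc : b ≠ c) {k : ℕ}
    (h1 : BiIndepUpAt (M.delete {c}) b (k + 1)) (h2 : BiIndepUpAt (M.delete {c}) b k) :
    BiIndepUpAt M b (k + 1) := by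
  unfold BiIndepUpAt at h1 h2 ⊢
  rw [through_ncard_of_isColoop M hc hbc k, avoid_ncard_of_isColoop M hc hbc (k + 1)]
  omega

/-! ## The coloop itself -/

/-- **THE THROUGH-`c` COUNT AT A COLOOP `c`**: `#{W ∈ D_{k+1} : c ∈ W} = D_k(M ＼ c)`. -/
lemma through_ncard_self_of_isColoop {c : α} (hc : M.IsColoop c) (k : ℕ) :
    {W ∈ biIndep M (k + 1) | c ∈ W}.ncard = biIndepCount (M.delete {c}) k := by
  classical
  unfold biIndepCount
  refine Set.ncard_congr (fun W _ => W \ {c}) ?_ ?_ ?_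
  · rintro W ⟨hW, hcW⟩
    exact (mem_biIndep_iff_sdiff_of_mem M hc hcW).mp hW
  · rintro W W' ⟨-, hcW⟩ ⟨-, hcW'⟩ h
    have h1 : insert c (W \ {c}) = insert c (W' \ {c}) := by rw [h]
    rwa [Set.insert_sdiff_singleton, Set.insert_sdiff_singleton, Set.insert_eq_of_mem hcW,
      Set.insert_eq_of_mem hcW'] at h1
  · intro U hU
    have hcU : c ∉ U := fun h => (hU.1 h).2 rfl
    refine ⟨insert c U, ⟨?_, Set.mem_insert c U⟩, ?_⟩
    · rw [mem_biIndep_iff_sdiff_of_mem M hc (Set.mem_insert c U), Set.insert_sdiff_of_mem _ (Set.mem_singleton c),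
        Set.sdiff_singleton_eq_self hcU]
      exact hU
    · rw [Set.insert_sdiff_of_mem _ (Set.mem_singleton c), Set.sdiff_singleton_eq_self hcU]

omit [M.Finite] in
/-- **THE AVOID-`c` COUNT AT A COLOOP `c`**: `#{Z ∈ D_k : c ∉ Z} = D_k(M ＼ c)`. -/
lemma avoid_ncard_self_of_isColoop {c : α} (hc : M.IsColoop c) (k : ℕ) :
    {Z ∈ biIndep M k | c ∉ Z}.ncard = biIndepCount (M.delete {c}) k := by
  classical
  unfold biIndepCount
  refine Set.ncard_congr (fun Z _ => Z) ?_ ?_ ?_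
  · rintro Z ⟨hZ, hcZ⟩
    exact (mem_biIndep_delete_iff_of_notMem M hc hcZ).mp hZ
  · intro Z Z' _ _ h; exact h
  · intro Z hZ
    have hcZ : c ∉ Z := fun h => (hZ.1 h).2 rfl
    exact ⟨Z, ⟨(mem_biIndep_delete_iff_of_notMem M hc hcZ).mpr hZ, hcZ⟩, rfl⟩

/-- **(↑) AT A COLOOP `c` AND LEVEL `k + 1`, FROM MONO OF `M ＼ c`** (`2k + 4 ≤ #E`): `D_k(M ＼ c) ≤ D_{k+2}(M ＼ c)`
by two steps of the monotone profile (the second step is the symmetry `D_{k+2} = D_{k+1}` at the exact middle). -/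
theorem upAt_self_of_isColoop {c : α} (hc : M.IsColoop c) {k : ℕ} (hn : 2 * k + 4 ≤ M.E.ncard)
    (hmono : BiIndepMono (M.delete {c})) : BiIndepUpAt M c (k + 1) := by
  classical
  haveI : (M.delete {c}).Finite := ⟨M.ground_finite.subset Set.sdiff_subset⟩
  unfold BiIndepUpAt
  rw [through_ncard_self_of_isColoop M hc k, avoid_ncard_self_of_isColoop M hc (k + 2)]
  have hcard : (M.delete {c}).E.ncard = M.E.ncard - 1 := by
    rw [Matroid.delete_ground, Set.ncard_sdiff_singleton_of_mem hc.mem_ground]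
  have hD1 : biIndepCount (M.delete {c}) k ≤ biIndepCount (M.delete {c}) (k + 1) :=
    biIndepCount_le_succ_of_mono (M.delete {c}) hmono (by rw [hcard]; omega)
  rcases Nat.lt_or_ge (2 * (k + 1) + 2) M.E.ncard with hmid | hmid
  · have hD2 : biIndepCount (M.delete {c}) (k + 1) ≤ biIndepCount (M.delete {c}) (k + 2) :=
      biIndepCount_le_succ_of_mono (M.delete {c}) hmono (by rw [hcard]; omega)
    exact hD1.trans hD2
  · -- the exact middle: `#E − 1 = 2k + 3`, so `D_{k+2} = D_{k+1}` by complementation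
    have heq : biIndepCount (M.delete {c}) (k + 2) = biIndepCount (M.delete {c}) (k + 1) := by
      have h := biIndepCount_compl (M.delete {c}) (k + 1) (by rw [hcard]; omega)
      rw [hcard] at h
      have e : M.E.ncard - 1 - (k + 1) = k + 2 := by omega
      rw [e] at h
      exact h
    rw [heq]
    exact hD1

omit [M.Finite] in
/-- **The nullity of `M ＼ c` is at most that of `M`**: `(M ＼ c)✶ = M✶ ／ c = M✶ ＼ c` for the loop `c` of `M✶`. -/
lemma eRank_dual_delete_isColoop_le {c : α} (hc : M.IsColoop c) : (M.delete {c})✶.eRank ≤ M✶.eRank := by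
  rw [Matroid.dual_delete]
  have hloop : ({c} : Set α) ⊆ M✶.loops := by
    rw [Set.singleton_subset_iff]; exact hc.dual_isLoop
  rw [Matroid.contract_eq_delete_of_subset_loops hloop]
  obtain ⟨B, hB⟩ := (M✶.delete {c}).exists_isBase
  rw [← hB.encard_eq_eRank]
  exact (Matroid.delete_indep_iff.mp hB.indep).1.encard_le_eRank

end PercRepro
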